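import Summits.MatrixMultiplication.MatrixMultiplication.Theorems.FarEdgeDescentAnchorLaw
import HarnessLib

/-!
# Route `FarEdgeDescent` — THE VALUE OF AN ANCHOR: next to the special leaf, `L(a)` IS the onset statement `E_a`
(lens-2 «special vs generic», gen 42; support module for the crux `AnchoredLogConvexity`
stmt-MatrixMultiplication-28900; companion of `FarEdgeDescentAnchorLaw`; def-free; cut of record UNCHANGED)

`e(x) = ω(1,x,1) − (x+1)`, `L(a) : ∀ m > a, e(m)² ≤ e(a)·e(2m−a)` (inline), `L(1) = AnchoredLogConvexity`.
`FarEdgeDescentAnchorLaw` showed that the special leaf turns any anchored law into saturation AT the anchor.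
Here the joint content of the two leaves is computed EXACTLY, uniformly in the anchor:

* `finiteSaturation_and_anchoredLaw_iff_onset` — **for every real `a`:
  `FiniteSaturation ∧ L(a) ⟺ E_a := ∀ x ≥ a, ω(1,x,1) = x + 1`** (far-tightness from `a` on — the rung
  of the sibling route `SaturationLadder`'s onset continuum).  At `a = 1` this is `ω = 2` (the route's cut
  `FiniteSaturation ∧ AnchoredLogConvexity ⟺ S`, tree `FarEdgeDescentChord.node_iff`); for `a < 1` both sides are
  false (flattening).  So, NEXT TO THE SPECIAL LEAF, sliding the generic leaf's anchor is exactly climbing the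
  onset ladder: `anchoredLaw_iff_onset_of_finiteSaturation`, and the family becomes a monotone DIAL
  (`anchoredLaw_mono_of_finiteSaturation`: `L(a) ⟹ L(b)` for `a ≤ b`, given `FiniteSaturation`).
* PRICES of the dial position `a ≥ 1` (both leaves assumed): `omega_le_of_finiteSaturation_of_anchoredLaw`
  **`ω ≤ 3(a+1)/(a+2) = 2 + (a−1)/(a+2)`** (cube line, tree `FarEdgeDescentTailFreedom.omega_farExcess_free`;
  the same price as `SaturationLadderOnsetContinuum.omega_le_of_far` / `FarEdgeDescentCornerFold.omega_le_tight`,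
  not imported here) and `alpha_ge_of_finiteSaturation_of_anchoredLaw` **`α ≥ 2/(a+1)`** (fold, tree
  `FarEdgeDescentPencilRealisability.omega_pencil_admissible`; the price of `FarEdgeDescentAlphaPrice`).  At
  `a = 1`: `ω ≤ 2` and `α ≥ 1` — the summit from both ends; as `a → ∞` the prices degenerate to `ω ≤ 3`, `α ≥ 0`.
* SHARPNESS of the ω-price against the 3D laws: `anchorValue_world` — for every `a > 1` a LAWFUL functional with
  `FiniteSaturation`-shape, `L(a)`-shape and `W(1,1,1) = 3(a+1)/(a+2)` EXACTLY (far excess `(a−x)₊/(a+2)` fed to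
  the landed far-tail freedom theorem `farTail_realisable`; this is the world of
  `FarEdgeDescentAnchorLaw.anchoredLaw_insufficient_of_one_lt` with its value computed).

Dichotomy reading: the generic leaf's whole one-parameter family, read against the special leaf, carries no
information beyond WHERE saturation starts; its surplus content (log-convexity of a POSITIVE excess) is visible
only in worlds where the special leaf fails — which is where `FarEdgeDescentLaplaceLaw` places it.
[cite: LottiRomani1983, §2 (p. 174)] [cite: HuangPan1998, §2 eq. (2.5)–(2.8)] [cite: Blaser2013, Thm. 5.9]
[cite: Coppersmith1997, §1]
-/

set_option linter.dupNamespace false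

noncomputable section

namespace Summit.MatrixMultiplication.MatrixMultiplication.Theorems.FarEdgeDescentAnchorValue

open Literature.Computability.AlgebraicComplexity Set
open Summit.MatrixMultiplication.MatrixMultiplication.Theses.FarEdgeDescent
open Summit.MatrixMultiplication.MatrixMultiplication.Theorems.FarEdgeDescentChord
open Summit.MatrixMultiplication.MatrixMultiplication.Theorems.FarEdgeDescentTailFreedom
open Summit.MatrixMultiplication.MatrixMultiplication.Theorems.FarEdgeDescentPencilRealisability
open Summit.MatrixMultiplication.MatrixMultiplication.Theorems.FarEdgeDescentTailShadow
open Summit.MatrixMultiplication.MatrixMultiplication.Theorems.FarEdgeDescentAnchorLaw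

/-! ## §1 The two leaves together are exactly the onset statement `E_a` — for every real anchor -/

/-- **`FiniteSaturation ∧ L(a) ⟺ E_a`** (`E_a : ∀ x ≥ a, ω(1,x,1) = x+1`), for EVERY real `a`.  `→`: saturation
at the anchor (`saturated_anchor_of_finiteSaturation`) and antitonicity / nonnegativity of the excess;
`←`: the integer `max 2 ⌈a⌉₊` witnesses the special leaf and all three excesses in `L(a)` vanish. -/
theorem finiteSaturation_and_anchoredLaw_iff_onset (a : ℝ) :
    (FiniteSaturation ∧ ∀ m : ℝ, a < m → (omegaRect ℂ 1 m 1 - (m + 1)) ^ 2 ≤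
        (omegaRect ℂ 1 a 1 - (a + 1)) * (omegaRect ℂ 1 (2 * m - a) 1 - (2 * m - a + 1))) ↔
      ∀ x : ℝ, a ≤ x → omegaRect ℂ 1 x 1 = x + 1 := by
  constructor
  · rintro ⟨hF, hL⟩ x hx
    have ha := saturated_anchor_of_finiteSaturation hF hL
    have h1 := excess_antitone (x := x) (y := a) hx
    have h2 := add_one_le_omegaRect_one_mid_one ℂ x
    rw [ha] at h1
    linarith
  · intro h
    refine ⟨⟨max 2 ⌈a⌉₊, le_max_left _ _, ?_⟩, fun m hm => ?_⟩
    · have hK : a ≤ ((max 2 ⌈a⌉₊ : ℕ) : ℝ) :=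
        (Nat.le_ceil a).trans (by exact_mod_cast le_max_right 2 ⌈a⌉₊)
      exact h _ hK
    · rw [h m hm.le, h a le_rfl, h (2 * m - a) (by linarith)]
      simp

/-- Hence, **given the special leaf, the anchored law `L(a)` IS the onset rung `E_a`** (every real `a`). -/
theorem anchoredLaw_iff_onset_of_finiteSaturation (hF : FiniteSaturation) (a : ℝ) :
    (∀ m : ℝ, a < m → (omegaRect ℂ 1 m 1 - (m + 1)) ^ 2 ≤
        (omegaRect ℂ 1 a 1 - (a + 1)) * (omegaRect ℂ 1 (2 * m - a) 1 - (2 * m - a + 1))) ↔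
      ∀ x : ℝ, a ≤ x → omegaRect ℂ 1 x 1 = x + 1 := by
  rw [← finiteSaturation_and_anchoredLaw_iff_onset a]
  exact ⟨fun hL => ⟨hF, hL⟩, fun h => h.2⟩

/-- … and the family is a monotone DIAL next to the special leaf: `L(a) ⟹ L(b)` for `a ≤ b`. -/
theorem anchoredLaw_mono_of_finiteSaturation (hF : FiniteSaturation) {a b : ℝ} (hab : a ≤ b)
    (hL : ∀ m : ℝ, a < m → (omegaRect ℂ 1 m 1 - (m + 1)) ^ 2 ≤
        (omegaRect ℂ 1 a 1 - (a + 1)) * (omegaRect ℂ 1 (2 * m - a) 1 - (2 * m - a + 1))) :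
    ∀ m : ℝ, b < m → (omegaRect ℂ 1 m 1 - (m + 1)) ^ 2 ≤
        (omegaRect ℂ 1 b 1 - (b + 1)) * (omegaRect ℂ 1 (2 * m - b) 1 - (2 * m - b + 1)) :=
  (anchoredLaw_iff_onset_of_finiteSaturation hF b).mpr fun x hx =>
    (anchoredLaw_iff_onset_of_finiteSaturation hF a).mp hL x (hab.trans hx)

/-- At the square the onset rung is the summit: `E_1 ⟹ ω = 2` (so `a = 1` recovers the route's `closes`). -/
theorem mm_of_onset_one (h : ∀ x : ℝ, 1 ≤ x → omegaRect ℂ 1 x 1 = x + 1) : _root_.MatrixMultiplication := by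
  rw [_root_.MatrixMultiplication_iff, ← omegaRect_one_one_one, h 1 le_rfl]
  norm_num

/-! ## §2 The prices of a dial position `a ≥ 1` -/

/-- **ω-price**: `FiniteSaturation ∧ L(a) ⟹ ω ≤ 3(a+1)/(a+2)` (`a ≥ 1`; cube line at the saturated anchor:
`e(1) ≤ (1 − e(1))·(a−1)/3`).  The same bound as the onset price `SaturationLadderOnsetContinuum.omega_le_of_far`.
[cite: Blaser2013, Thm. 5.9] -/
theorem omega_le_of_finiteSaturation_of_anchoredLaw {a : ℝ} (ha : 1 ≤ a) (hF : FiniteSaturation)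
    (hL : ∀ m : ℝ, a < m → (omegaRect ℂ 1 m 1 - (m + 1)) ^ 2 ≤
        (omegaRect ℂ 1 a 1 - (a + 1)) * (omegaRect ℂ 1 (2 * m - a) 1 - (2 * m - a + 1))) :
    omega ℂ ≤ 3 * (a + 1) / (a + 2) := by
  have hsat := saturated_anchor_of_finiteSaturation hF hL
  have hcube := omega_farExcess_free.2.2.2 a ha
  rw [hsat, omegaRect_one_one_one] at hcube
  have ha2 : (0 : ℝ) < a + 2 := by linarith
  rw [le_div_iff₀ ha2]
  nlinarith

/-- **α-price**: `FiniteSaturation ∧ L(a) ⟹ α ≥ 2/(a+1)` (`a > 0`; the fold at the saturated anchor gives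
`ω(1, 2/(a+1), 1) = 2`).  The same price as `FarEdgeDescentAlphaPrice.alpha_ge_of_saturated`.
[cite: Coppersmith1997, §1] [cite: HuangPan1998, §2] -/
theorem alpha_ge_of_finiteSaturation_of_anchoredLaw {a : ℝ} (ha : 0 < a) (hF : FiniteSaturation)
    (hL : ∀ m : ℝ, a < m → (omegaRect ℂ 1 m 1 - (m + 1)) ^ 2 ≤
        (omegaRect ℂ 1 a 1 - (a + 1)) * (omegaRect ℂ 1 (2 * m - a) 1 - (2 * m - a + 1))) :
    2 / (a + 1) ≤ dualExponentAlpha ℂ := by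
  have hsat := saturated_anchor_of_finiteSaturation hF hL
  have hfold := omega_pencil_admissible.2.2.2.2.2 a ha
  rw [hsat] at hfold
  have h2 := two_le_omegaRect_one_mid_one ℂ (2 / (1 + a))
  have heq : omegaRect ℂ 1 (2 / (1 + a)) 1 = 2 := by
    apply le_antisymm _ h2
    by_contra hlt
    rw [not_le] at hlt
    nlinarith
  have := le_dualExponentAlpha_of_omegaRect_eq_two ℂ heq
  rwa [add_comm] at this

/-- Both prices at once; at `a = 1` they read `ω ≤ 2` and `α ≥ 1` — the summit from both ends. -/
theorem prices_of_finiteSaturation_of_anchoredLaw {a : ℝ} (ha : 1 ≤ a) (hF : FiniteSaturation)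
    (hL : ∀ m : ℝ, a < m → (omegaRect ℂ 1 m 1 - (m + 1)) ^ 2 ≤
        (omegaRect ℂ 1 a 1 - (a + 1)) * (omegaRect ℂ 1 (2 * m - a) 1 - (2 * m - a + 1))) :
    omega ℂ ≤ 3 * (a + 1) / (a + 2) ∧ 2 / (a + 1) ≤ dualExponentAlpha ℂ :=
  ⟨omega_le_of_finiteSaturation_of_anchoredLaw ha hF hL,
    alpha_ge_of_finiteSaturation_of_anchoredLaw (by linarith) hF hL⟩

/-! ## §3 The ω-price is sharp against the 3D laws -/

/-- **Sharpness of the ω-price in a lawful world.**  For every `a > 1` there is a 3D-LAWFUL functional `W`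
(symmetric, positively homogeneous, subadditive, monotone in the middle argument, sandwiched) with
`FiniteSaturation`-shape, `L(a)`-shape and `W(1,1,1) = 3(a+1)/(a+2)` EXACTLY — the far excess `(a − x)₊/(a+2)`
fed to `farTail_realisable`.  So among the shape laws the pair (special leaf, `L(a)`) is worth precisely
`ω ≤ 3(a+1)/(a+2)`, and is the summit only at `a = 1`. -/
theorem anchorValue_world {a : ℝ} (ha : 1 < a) :
    ∃ W : ℝ → ℝ → ℝ → ℝ,
      ((∀ x y z : ℝ, W x y z = W y x z ∧ W x y z = W x z y) ∧
        (∀ ν : ℝ, 0 < ν → ∀ x y z : ℝ, 0 < x → 0 < y → 0 < z →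
          W (ν * x) (ν * y) (ν * z) = ν * W x y z) ∧
        (∀ x y z x' y' z' : ℝ, 0 < x → 0 < y → 0 < z → 0 < x' → 0 < y' → 0 < z' →
          W (x + x') (y + y') (z + z') ≤ W x y z + W x' y' z') ∧
        (∀ x y y' z : ℝ, 0 < x → 0 < y → y ≤ y' → 0 < z → W x y z ≤ W x y' z) ∧
        (∀ x y z : ℝ, 0 < x → 0 < y → 0 < z →
          max (x + z) (max (x + y) (y + z)) ≤ W x y z ∧ W x y z ≤ x + y + z)) ∧
      (∃ K : ℕ, 2 ≤ K ∧ W 1 K 1 = K + 1) ∧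
      (∀ m : ℝ, a < m → (W 1 m 1 - (m + 1)) ^ 2 ≤ (W 1 a 1 - (a + 1)) * (W 1 (2 * m - a) 1 - (2 * m - a + 1))) ∧
      W 1 1 1 = 3 * (a + 1) / (a + 2) := by
  set c : ℝ := (a + 2)⁻¹ with hc_def
  have hc : 0 < c := by rw [hc_def]; positivity
  have hc1 : c * (a + 2) = 1 := by rw [hc_def]; exact inv_mul_cancel₀ (by linarith)
  set g : ℝ → ℝ := fun x => c • max (a - x) 0 with hg_def
  have hg : ∀ x, g x = c * max (a - x) 0 := fun x => by simp [hg_def, smul_eq_mul]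
  have hconv : ConvexOn ℝ (Ici 1) g := by
    have h1 : ConvexOn ℝ (Ici (1 : ℝ)) (fun x : ℝ => a - x) :=
      (convexOn_const (𝕜 := ℝ) a (convex_Ici (1 : ℝ))).sub (concaveOn_id (convex_Ici (1 : ℝ)))
    have h2 : ConvexOn ℝ (Ici (1 : ℝ)) (fun x : ℝ => max (a - x) 0) :=
      h1.sup (convexOn_const (𝕜 := ℝ) (0 : ℝ) (convex_Ici (1 : ℝ)))
    have h3 : ConvexOn ℝ (Ici (1 : ℝ)) (fun x : ℝ => c • max (a - x) 0) := h2.smul hc.le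
    rw [hg_def]; exact h3
  have hanti : AntitoneOn g (Ici 1) := by
    intro x _ y _ hxy
    rw [hg, hg]
    exact mul_le_mul_of_nonneg_left (max_le_max (by linarith) le_rfl) hc.le
  have hnn : ∀ x : ℝ, 1 ≤ x → 0 ≤ g x := fun x _ => by
    rw [hg]; exact mul_nonneg hc.le (le_max_right _ _)
  have hg1 : g 1 = c * (a - 1) := by rw [hg, max_eq_left (by linarith)]
  have hcube : ∀ x : ℝ, 1 ≤ x → g 1 - g x ≤ (1 - g 1) / 3 * (x - 1) := by
    intro x hx
    have key : (a - 1) - max (a - x) 0 ≤ x - 1 := by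
      rcases le_total (a - x) 0 with h | h
      · rw [max_eq_right h]; linarith
      · rw [max_eq_left h]; linarith
    have h3 : (1 - g 1) / 3 = c := by rw [hg1]; linarith
    rw [h3, hg1, hg]
    nlinarith [mul_le_mul_of_nonneg_left key hc.le]
  obtain ⟨W, hsym, hhom, hsub, hmono, hsand, hfar, hone⟩ := farTail_realisable hconv hanti hnn hcube
  refine ⟨W, ⟨hsym, hhom, hsub, hmono, hsand⟩, ?_, ?_, ?_⟩
  · refine ⟨⌈a⌉₊, ?_, ?_⟩
    · have h2 : (1 : ℝ) < ⌈a⌉₊ := lt_of_lt_of_le ha (Nat.le_ceil a)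
      have h3 : (1 : ℕ) < ⌈a⌉₊ := by exact_mod_cast h2
      omega
    · have hKa : a ≤ (⌈a⌉₊ : ℝ) := Nat.le_ceil a
      rw [hfar _ (by linarith), hg, max_eq_right (by linarith)]
      ring
  · intro m hm
    rw [hfar m (by linarith), hfar a ha.le, hfar (2 * m - a) (by linarith), hg m, hg a,
      max_eq_right (by linarith : a - m ≤ 0), max_eq_right (by linarith : a - a ≤ 0)]
    simp
  · rw [hone, hg1, eq_div_iff (by linarith : (a + 2 : ℝ) ≠ 0)]
    nlinarith [hc1]

/-- The ω-price function `a ↦ 3(a+1)/(a+2) = 2 + (a−1)/(a+2)` of the dial: value `2` exactly at the square,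
strictly increasing, below `3`. -/
theorem anchorValue_facts :
    (3 * ((1 : ℝ) + 1) / (1 + 2) = 2) ∧
    (∀ a b : ℝ, 1 ≤ a → a < b → 3 * (a + 1) / (a + 2) < 3 * (b + 1) / (b + 2)) ∧
    (∀ a : ℝ, 1 ≤ a → 3 * (a + 1) / (a + 2) < 3) := by
  refine ⟨by norm_num, fun a b ha hab => ?_, fun a ha => ?_⟩
  · rw [div_lt_div_iff₀ (by linarith) (by linarith)]
    nlinarith
  · rw [div_lt_iff₀ (by linarith)]
    linarith

end Summit.MatrixMultiplication.MatrixMultiplication.Theorems.FarEdgeDescentAnchorValue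

end
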